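import Literature.NumberTheory.LFunctions.WienerIkeharaTauberian
import Mathlib.Analysis.Fourier.RiemannLebesgueLemma
import Mathlib.MeasureTheory.Integral.ExpDecay
import Mathlib.MeasureTheory.Integral.Prod
import HarnessLib

/-!
# Wiener–Ikehara theorem, analytic step and Laplace-transform form

Topic `Literature/NumberTheory/LFunctions`. Third of four files proving `Literature.NumberTheory.LFunctions.WienerIkehara`
(Montgomery–Vaughan 2007, Cor. 8.8), classical proof (Ikehara–Bochner–Landau; Chandrasekharan
1968, Ch. XI §2). Setting: `B : ℝ → ℝ` measurable, non-negative, vanishing on `u < 0`, with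
`∫_0^∞ B(u) e^{-εu} du < ∞` for every `ε > 0`, and a function `G` continuous on the closed
half-plane `Re s ≥ 1` with

  `G(s) = ∫_0^∞ (B(u) − c) e^{-(s−1)u} du`   for `Re s > 1`.

* `laplace_fubini`: for `ε > 0`,
  `∫_{-2λ}^{2λ} G(1+ε+it) (1 − |t|/2λ) e^{ity} dt = ∫_0^∞ (B(u) − c) e^{-εu} K_λ(y − u) du`
  (Fubini + the Fourier identity of `WienerIkeharaKernel`).
* `ε → 0+`: dominated convergence on the left (continuity of `G` on a compact rectangle),
  monotone convergence on the right, giving integrability of `B K_λ(y − ·)` and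
  `∫_0^∞ B(u) K_λ(y−u) du = ∫_{-2λ}^{2λ} G(1+it)(1−|t|/2λ)e^{ity} dt + c ∫_0^∞ K_λ(y−u) du`.
* `y → ∞`: the Riemann–Lebesgue lemma (Mathlib) kills the first term, the second tends to
  `c ∫_ℝ K_1`; with the Tauberian step (`WienerIkeharaTauberian`) this yields
  `tendsto_of_laplace`: if moreover `B(v) ≥ e^{u−v} B(u)` for `u ≤ v`, then `B(y) → c`.

## References

* H. L. Montgomery, R. C. Vaughan, *Multiplicative Number Theory I. Classical Theory*, CUP 2007,
  §8.3, Thm. 8.6 and its proof (Fubini, `δ → 0⁺` by continuity of `r(s)` on the closed strip,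
  Riemann–Lebesgue on a finite section of `Re s = 1`).
* K. Chandrasekharan, *Introduction to Analytic Number Theory*, Springer 1968, Ch. XI §2.
-/

noncomputable section

open Real MeasureTheory Filter Set intervalIntegral Complex
open scoped Topology FourierTransform

namespace Literature.NumberTheory.LFunctions.WienerIkehara

/-! ## Fubini step -/

/-- Exponential bookkeeping: `e^{-(ε+it)u} e^{ity} = e^{-εu} e^{it(y-u)}`. [folklore] -/
theorem cexp_laplace_mul_cexp (ε t u y : ℝ) :
    Complex.exp (-((ε : ℂ) + I * t) * u) * Complex.exp (I * t * y)
      = ((rexp (-(ε * u)) : ℝ) : ℂ) * Complex.exp (I * t * ((y - u : ℝ) : ℂ)) := by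
  rw [Complex.ofReal_exp, ← Complex.exp_add, ← Complex.exp_add]
  congr 1
  push_cast
  ring

/-- **Fubini step.** For `ε > 0`, `λ > 0` and real `y`: if
`G(t) = ∫_0^∞ (B(u) − c) e^{-(ε+it)u} du` for all real `t` (the Laplace transform on the line
`Re s = 1 + ε`), then
`∫_{(-2λ, 2λ]} G(t) (1 − |t|/2λ) e^{ity} dt = ∫_0^∞ (B(u) − c) e^{-εu} K_λ(y − u) du`.
(Montgomery–Vaughan 2007, proof of Thm. 8.6, eq. (8.41).) [cite: MontgomeryVaughan2007, §8.3 (8.41)] -/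
theorem laplace_fubini {B : ℝ → ℝ} (hBm : Measurable B) (c : ℝ) {ε : ℝ} (hε : 0 < ε)
    (hgr : IntegrableOn (fun u => B u * rexp (-(ε * u))) (Ioi 0)) {l : ℝ} (hl : 0 < l) (y : ℝ)
    (G : ℝ → ℂ)
    (hG : ∀ t : ℝ, G t = ∫ u in Ioi (0 : ℝ), ((B u - c : ℝ) : ℂ) * Complex.exp (-((ε : ℂ) + I * t) * u)) :
    ∫ t in Ioc (-(2 * l)) (2 * l), G t * ((1 - |t| / (2 * l) : ℝ) : ℂ) * Complex.exp (I * t * y)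
      = ((∫ u in Ioi (0 : ℝ), (B u - c) * rexp (-(ε * u)) * (2 * l * sinc (l * (y - u)) ^ 2)
          : ℝ) : ℂ) := by
  -- the integrand of the double integral
  set F : ℝ → ℝ → ℂ := fun t u =>
    (((B u - c) * rexp (-(ε * u)) : ℝ) : ℂ) *
      ((((1 - |t| / (2 * l)) : ℝ) : ℂ) * Complex.exp (I * t * ((y - u : ℝ) : ℂ))) with hF_def
  -- Step 1: the left side is `∫_t ∫_u F`
  have h1 : ∀ t : ℝ, G t * ((1 - |t| / (2 * l) : ℝ) : ℂ) * Complex.exp (I * t * y)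
      = ∫ u in Ioi (0 : ℝ), F t u := by
    intro t
    rw [hG t, mul_assoc, ← MeasureTheory.integral_mul_const]
    refine setIntegral_congr_fun measurableSet_Ioi fun u _ => ?_
    simp only [hF_def]
    rw [show ((B u - c : ℝ) : ℂ) * Complex.exp (-((ε : ℂ) + I * t) * u) * (((1 - |t| / (2 * l) : ℝ) : ℂ)
        * Complex.exp (I * t * y)) = ((B u - c : ℝ) : ℂ) * (((1 - |t| / (2 * l) : ℝ) : ℂ))
        * (Complex.exp (-((ε : ℂ) + I * t) * u) * Complex.exp (I * t * y)) by ring, cexp_laplace_mul_cexp]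
    push_cast
    ring
  simp_rw [h1]
  -- integrability of `uncurry F` on the product
  have hgr' : IntegrableOn (fun u => (B u - c) * rexp (-(ε * u))) (Ioi 0) := by
    have h2 : IntegrableOn (fun u => c * rexp (-(ε * u))) (Ioi 0) :=
      ((exp_neg_integrableOn_Ioi 0 hε).congr_fun (fun u _ => by ring_nf) measurableSet_Ioi).const_mul c
    exact (hgr.sub h2).congr_fun (fun u _ => by simp only [Pi.sub_apply]; ring) measurableSet_Ioi
  have hFint : Integrable (Function.uncurry F)
      ((volume.restrict (Ioc (-(2 * l)) (2 * l))).prod (volume.restrict (Ioi (0 : ℝ)))) := by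
    refine Integrable.mono'
      ((integrable_const (1 : ℝ)).mul_prod hgr'.norm) ?_ ?_
    · refine Measurable.aestronglyMeasurable ?_
      simp only [hF_def, Function.uncurry_def]
      have hBm2 : Measurable fun p : ℝ × ℝ => B p.2 := hBm.comp measurable_snd
      fun_prop
    · have hae : ∀ᵐ p : ℝ × ℝ ∂((volume.restrict (Ioc (-(2 * l)) (2 * l))).prod
          (volume.restrict (Ioi (0 : ℝ)))), p ∈ Ioc (-(2 * l)) (2 * l) ×ˢ Ioi (0 : ℝ) := by
        rw [Measure.prod_restrict]
        exact ae_restrict_mem (measurableSet_Ioc.prod measurableSet_Ioi)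
      filter_upwards [hae] with p hp
      rw [Set.mem_prod, Set.mem_Ioc] at hp
      obtain ⟨t, u⟩ := p
      simp only [hF_def, Function.uncurry_apply_pair, norm_mul, one_mul, Complex.norm_real]
      simp only at hp
      have hw : ‖(1 - |t| / (2 * l) : ℝ)‖ ≤ 1 := by
        rw [Real.norm_eq_abs, abs_le]
        have h3 : |t| ≤ 2 * l := abs_le.mpr ⟨hp.1.1.le, hp.1.2⟩
        have h5 : |t| / (2 * l) ≤ 1 := by rw [div_le_one (by linarith)]; exact h3
        have h6 : 0 ≤ |t| / (2 * l) := by positivity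
        constructor <;> linarith
      have he : ‖Complex.exp (I * (t : ℂ) * ((y - u : ℝ) : ℂ))‖ = 1 := by
        rw [show I * (t : ℂ) * ((y - u : ℝ) : ℂ) = ((t * (y - u) : ℝ) : ℂ) * I by
          push_cast; ring, Complex.norm_exp_ofReal_mul_I]
      rw [he, mul_one]
      exact mul_le_of_le_one_right (by positivity) hw
  -- Step 2: swap
  rw [integral_integral_swap hFint]
  -- Step 3: inner integral
  rw [← integral_complex_ofReal]
  refine setIntegral_congr_fun measurableSet_Ioi fun u _ => ?_
  simp only [hF_def]
  rw [MeasureTheory.integral_const_mul, ← intervalIntegral.integral_of_le (by linarith),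
    integral_triangle_mul_exp hl (y - u)]
  push_cast
  ring

/-! ## The limit `ε → 0+` on the boundary side -/

/-- `t ↦ G(1 + ε + it)` is continuous for `ε ≥ 0` when `G` is continuous on `Re s ≥ 1`. [folklore] -/
theorem continuous_boundary {G : ℂ → ℂ} (hG : ContinuousOn G {s : ℂ | 1 ≤ s.re}) {ε : ℝ}
    (hε : 0 ≤ ε) : Continuous fun t : ℝ => G (1 + ε + I * t) := by
  refine hG.comp_continuous (by fun_prop) fun t => ?_
  simp [hε]

/-- Dominated convergence on the finite section of the boundary: as `ε → 0⁺`,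
`∫_{(-2λ,2λ]} G(1+ε+it) (1−|t|/2λ) e^{ity} dt → ∫_{(-2λ,2λ]} G(1+it) (1−|t|/2λ) e^{ity} dt`,
by continuity (hence boundedness) of `G` on the compact rectangle `[1,2] × [-2λ,2λ]`.
(Montgomery–Vaughan 2007, proof of Thm. 8.6: "since `r(s)` is uniformly continuous in the closed
rectangle … each of the terms tends to a limit as `δ → 0⁺`".) [cite: MontgomeryVaughan2007, §8.3, proof of Thm. 8.6] -/
theorem tendsto_boundary_integral {G : ℂ → ℂ} (hG : ContinuousOn G {s : ℂ | 1 ≤ s.re})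
    {l : ℝ} (hl : 0 < l) (y : ℝ) :
    Tendsto (fun ε : ℝ => ∫ t in Ioc (-(2 * l)) (2 * l),
        G (1 + ε + I * t) * ((1 - |t| / (2 * l) : ℝ) : ℂ) * Complex.exp (I * t * y))
      (𝓝[>] 0)
      (𝓝 (∫ t in Ioc (-(2 * l)) (2 * l),
        G (1 + I * t) * ((1 - |t| / (2 * l) : ℝ) : ℂ) * Complex.exp (I * t * y))) := by
  -- a bound for `G` on the compact rectangle
  obtain ⟨C, hC⟩ := (isCompact_Icc.reProdIm isCompact_Icc :
    IsCompact (Icc (1 : ℝ) 2 ×ℂ Icc (-(2 * l)) (2 * l))).exists_bound_of_continuousOn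
      (hG.mono fun z hz => (Complex.mem_reProdIm.1 hz).1.1)
  have hC0 : 0 ≤ C := (norm_nonneg _).trans (hC 1 (by simp [Complex.mem_reProdIm, hl.le]))
  refine tendsto_integral_filter_of_dominated_convergence (fun _ => C) ?_ ?_ (integrable_const C) ?_
  · filter_upwards [self_mem_nhdsWithin] with ε (hε : 0 < ε)
    exact (((continuous_boundary hG hε.le).mul (by fun_prop)).mul (by fun_prop)).aestronglyMeasurable
  · filter_upwards [Ioc_mem_nhdsGT (zero_lt_one' ℝ)] with ε hε
    filter_upwards [ae_restrict_mem measurableSet_Ioc] with t ht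
    rw [norm_mul, norm_mul, show I * (t : ℂ) * y = ((t * y : ℝ) : ℂ) * I by push_cast; ring,
      Complex.norm_exp_ofReal_mul_I, mul_one, Complex.norm_real]
    have hw : ‖(1 - |t| / (2 * l) : ℝ)‖ ≤ 1 := by
      rw [Real.norm_eq_abs, abs_le]
      have h3 : |t| ≤ 2 * l := abs_le.mpr ⟨ht.1.le, ht.2⟩
      have h5 : |t| / (2 * l) ≤ 1 := by rw [div_le_one (by linarith)]; exact h3
      have h6 : 0 ≤ |t| / (2 * l) := by positivity
      constructor <;> linarith
    have hGt : ‖G (1 + ε + I * t)‖ ≤ C := by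
      refine hC _ (Complex.mem_reProdIm.2 ⟨?_, ?_⟩)
      · simp only [add_re, one_re, ofReal_re, mul_re, I_re, zero_mul, I_im, ofReal_im, mul_zero,
          sub_zero, add_zero, mem_Icc]
        constructor <;> linarith [hε.1, hε.2]
      · simp only [add_im, one_im, ofReal_im, mul_im, I_re, zero_mul, I_im, ofReal_re, one_mul,
          zero_add, mem_Icc]
        exact ⟨ht.1.le, ht.2⟩
    calc ‖G (1 + ε + I * t)‖ * ‖(1 - |t| / (2 * l) : ℝ)‖ ≤ C * 1 := by gcongr
      _ = C := mul_one C
  · filter_upwards with t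
    refine ((ContinuousWithinAt.tendsto (s := {s : ℂ | 1 ≤ s.re}) ?_).comp ?_).mul_const _
      |>.mul_const _
    · exact hG _ (by simp)
    · rw [tendsto_nhdsWithin_iff]
      constructor
      · have : Continuous fun ε : ℝ => (1 : ℂ) + ε + I * t := by fun_prop
        simpa using (this.tendsto 0).mono_left nhdsWithin_le_nhds
      · filter_upwards [self_mem_nhdsWithin] with ε (hε : 0 < ε)
        simp [hε.le]

/-- Dominated convergence for the `c`-term: as `ε → 0⁺`,
`∫_0^∞ e^{-εu} K_λ(y−u) du → ∫_0^∞ K_λ(y−u) du`. [folklore] -/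
theorem tendsto_exp_fejer_integral {l : ℝ} (hl : 0 < l) (y : ℝ) :
    Tendsto (fun ε : ℝ => ∫ u in Ioi (0 : ℝ), rexp (-(ε * u)) * (2 * l * sinc (l * (y - u)) ^ 2))
      (𝓝[>] 0) (𝓝 (∫ u in Ioi (0 : ℝ), 2 * l * sinc (l * (y - u)) ^ 2)) := by
  have hK : Integrable fun u => 2 * l * sinc (l * (y - u)) ^ 2 :=
    (integrable_fejer hl).comp_sub_left y
  refine tendsto_integral_filter_of_dominated_convergence
    (fun u => 2 * l * sinc (l * (y - u)) ^ 2) ?_ ?_ hK.integrableOn ?_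
  · filter_upwards with ε
    exact (by fun_prop : Continuous fun u => rexp (-(ε * u)) * (2 * l * sinc (l * (y - u)) ^ 2))
      |>.aestronglyMeasurable
  · filter_upwards [self_mem_nhdsWithin] with ε (hε : 0 < ε)
    filter_upwards [ae_restrict_mem measurableSet_Ioi] with u (hu : 0 < u)
    rw [Real.norm_eq_abs, abs_of_nonneg (mul_nonneg (exp_pos _).le (fejer_nonneg hl.le _))]
    refine mul_le_of_le_one_left (fejer_nonneg hl.le _) ?_
    rw [exp_le_one_iff]
    nlinarith
  · filter_upwards with u
    have : Continuous fun ε : ℝ => rexp (-(ε * u)) * (2 * l * sinc (l * (y - u)) ^ 2) := by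
      fun_prop
    simpa using (this.tendsto 0).mono_left nhdsWithin_le_nhds

/-! ## Riemann–Lebesgue on the boundary -/

/-- As `y → ∞`, `∫_{(-2λ,2λ]} G(1+it) (1−|t|/2λ) e^{ity} dt → 0` (Riemann–Lebesgue lemma for the
integrable function `1_{(-2λ,2λ]}(t) G(1+it)(1−|t|/2λ)`; Mathlib's
`Real.tendsto_integral_exp_smul_cocompact`). (Montgomery–Vaughan 2007, proof of Thm. 8.6: "the
first integral on the right tends to 0 by the Riemann–Lebesgue lemma".) [cite: MontgomeryVaughan2007, §8.3, proof of Thm. 8.6] -/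
theorem tendsto_boundary_integral_atTop (G : ℂ → ℂ) (l : ℝ) :
    Tendsto (fun y : ℝ => ∫ t in Ioc (-(2 * l)) (2 * l),
        G (1 + I * t) * ((1 - |t| / (2 * l) : ℝ) : ℂ) * Complex.exp (I * t * y)) atTop (𝓝 0) := by
  set h : ℝ → ℂ := (Ioc (-(2 * l)) (2 * l)).indicator
    fun t => G (1 + I * t) * ((1 - |t| / (2 * l) : ℝ) : ℂ) with hh
  have h1 := Real.tendsto_integral_exp_smul_cocompact h
  have h2 : Tendsto (fun y : ℝ => -y / (2 * π)) atTop (cocompact ℝ) :=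
    (tendsto_neg_atTop_atBot.atBot_div_const (by positivity)).mono_right atBot_le_cocompact
  refine (h1.comp h2).congr fun y => ?_
  simp only [Function.comp_apply]
  rw [← MeasureTheory.integral_indicator measurableSet_Ioc]
  congr 1
  ext t
  rw [Circle.smul_def, Real.fourierChar_apply, smul_eq_mul, hh]
  by_cases ht : t ∈ Ioc (-(2 * l)) (2 * l)
  · simp only [indicator_of_mem ht]
    rw [show ((2 * π * -(t * (-y / (2 * π))) : ℝ) : ℂ) * I = I * t * y by
      push_cast; field_simp]
    ring
  · simp only [indicator_of_notMem ht, mul_zero]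

/-! ## Monotone convergence on the `B`-side -/

/-- **Monotone convergence step.** If `B ≥ 0` is measurable with `B e^{-ε·}` integrable on
`(0, ∞)` for every `ε > 0`, and the damped Fejér means
`J(ε) = ∫_0^∞ B(u) e^{-εu} K_λ(y − u) du` converge to `L` as `ε → 0⁺`, then `B K_λ(y − ·)` is
integrable on `(0, ∞)` and `∫_0^∞ B(u) K_λ(y−u) du = L`. [folklore] -/
theorem integrableOn_of_tendsto_damped {B : ℝ → ℝ} (hB0 : ∀ u, 0 ≤ B u)
    (hgr : ∀ ε : ℝ, 0 < ε → IntegrableOn (fun u => B u * rexp (-(ε * u))) (Ioi 0))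
    {l : ℝ} (hl : 0 < l) (y : ℝ) {L : ℝ}
    (hJ : Tendsto (fun ε : ℝ => ∫ u in Ioi (0 : ℝ),
        B u * rexp (-(ε * u)) * (2 * l * sinc (l * (y - u)) ^ 2)) (𝓝[>] 0) (𝓝 L)) :
    IntegrableOn (fun u => B u * (2 * l * sinc (l * (y - u)) ^ 2)) (Ioi 0) ∧
      ∫ u in Ioi (0 : ℝ), B u * (2 * l * sinc (l * (y - u)) ^ 2) = L := by
  set K : ℝ → ℝ := fun u => 2 * l * sinc (l * (y - u)) ^ 2 with hK_def
  have hKc : Continuous K := by rw [hK_def]; fun_prop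
  have hK0 : ∀ u, 0 ≤ K u := fun u => fejer_nonneg hl.le _
  have hKle : ∀ u, ‖K u‖ ≤ 2 * l := fun u => by
    rw [Real.norm_of_nonneg (hK0 u)]; exact fejer_le hl.le _
  set f : ℕ → ℝ → ℝ := fun n u => B u * rexp (-(1 / ((n : ℝ) + 1) * u)) * K u with hf_def
  have hf0 : ∀ n u, 0 ≤ f n u := fun n u => mul_nonneg (mul_nonneg (hB0 u) (exp_pos _).le) (hK0 u)
  have hfi : ∀ n, IntegrableOn (f n) (Ioi 0) := fun n =>
    (hgr (1 / ((n : ℝ) + 1)) (by positivity)).mul_bdd hKc.aestronglyMeasurable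
      (Eventually.of_forall hKle)
  -- monotonicity in `n`
  have hmono : ∀ u, 0 < u → Monotone fun n => f n u := by
    intro u hu n m hnm
    simp only [hf_def]
    gcongr
    exact hB0 u
  -- the sequence of integrals
  have hseq : Tendsto (fun n : ℕ => 1 / ((n : ℝ) + 1)) atTop (𝓝[>] 0) :=
    tendsto_nhdsWithin_iff.2 ⟨tendsto_one_div_add_atTop_nhds_zero_nat,
      Eventually.of_forall fun n => show (0 : ℝ) < 1 / ((n : ℝ) + 1) by positivity⟩
  have hJseq : Tendsto (fun n : ℕ => ∫ u in Ioi (0 : ℝ), f n u) atTop (𝓝 L) := hJ.comp hseq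
  have hJmono : Monotone fun n : ℕ => ∫ u in Ioi (0 : ℝ), f n u := by
    intro n m hnm
    exact setIntegral_mono_on (hfi n) (hfi m) measurableSet_Ioi fun u hu => hmono u hu hnm
  have hJle : ∀ n, ∫ u in Ioi (0 : ℝ), f n u ≤ L := fun n => hJmono.ge_of_tendsto hJseq n
  -- pointwise limit
  have hlim : ∀ u, Tendsto (fun n => f n u) atTop (𝓝 (B u * K u)) := by
    intro u
    have h1 : Tendsto (fun n : ℕ => rexp (-(1 / ((n : ℝ) + 1) * u))) atTop (𝓝 (rexp (-(0 * u)))) :=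
      (Real.continuous_exp.tendsto _).comp
        ((tendsto_one_div_add_atTop_nhds_zero_nat.mul_const u).neg)
    simp only [zero_mul, neg_zero, Real.exp_zero] at h1
    simp only [hf_def]
    simpa only [mul_one] using (h1.const_mul (B u)).mul_const (K u)
  -- integrability of the limit
  have hint : IntegrableOn (fun u => B u * K u) (Ioi 0) := by
    refine MeasureTheory.integrable_of_tendsto (μ := volume.restrict (Ioi 0))
      (Eventually.of_forall hlim) (fun n => (hfi n).aestronglyMeasurable) ?_
    have hlint : ∀ n, ∫⁻ u in Ioi 0, ‖f n u‖ₑ = ENNReal.ofReal (∫ u in Ioi (0 : ℝ), f n u) := by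
      intro n
      rw [← ofReal_integral_norm_eq_lintegral_enorm (hfi n)]
      congr 1
      exact integral_congr_ae (Eventually.of_forall fun u => Real.norm_of_nonneg (hf0 n u))
    simp_rw [hlint]
    refine ne_top_of_le_ne_top (ENNReal.ofReal_ne_top (r := L))
      (liminf_le_of_le (by isBoundedDefault) ?_)
    intro b hb
    obtain ⟨n, hn⟩ := hb.exists
    exact hn.trans (ENNReal.ofReal_le_ofReal (hJle n))
  refine ⟨hint, ?_⟩
  -- value of the limit
  have h2 : Tendsto (fun n : ℕ => ∫ u in Ioi (0 : ℝ), f n u) atTop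
      (𝓝 (∫ u in Ioi (0 : ℝ), B u * K u)) :=
    integral_tendsto_of_tendsto_of_monotone (fun n => hfi n) hint
      ((ae_restrict_mem measurableSet_Ioi).mono fun u hu => hmono u hu)
      (Eventually.of_forall hlim)
  exact tendsto_nhds_unique h2 hJseq

/-! ## Assembly -/

/-- **Fejér means via the boundary values.** Under the hypotheses of the file header, for every
`λ > 0` and real `y`, `B K_λ(y − ·)` is integrable on `(0, ∞)` and
`∫_0^∞ B(u) K_λ(y−u) du = Re ∫_{(-2λ,2λ]} G(1+it)(1−|t|/2λ)e^{ity} dt + c ∫_0^∞ K_λ(y−u) du`.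
(Montgomery–Vaughan 2007, proof of Thm. 8.6, the display after (8.41) with `δ → 0⁺`.)
[cite: MontgomeryVaughan2007, §8.3, proof of Thm. 8.6] -/
theorem fejerMean_eq_boundary {B : ℝ → ℝ} (hBm : Measurable B) (hB0 : ∀ u, 0 ≤ B u) (c : ℝ)
    (hgr : ∀ ε : ℝ, 0 < ε → IntegrableOn (fun u => B u * rexp (-(ε * u))) (Ioi 0))
    {G : ℂ → ℂ} (hG : ContinuousOn G {s : ℂ | 1 ≤ s.re})
    (hGeq : ∀ s : ℂ, 1 < s.re →
      G s = ∫ u in Ioi (0 : ℝ), ((B u - c : ℝ) : ℂ) * Complex.exp (-(s - 1) * u))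
    {l : ℝ} (hl : 0 < l) (y : ℝ) :
    IntegrableOn (fun u => B u * (2 * l * sinc (l * (y - u)) ^ 2)) (Ioi 0) ∧
      ∫ u in Ioi (0 : ℝ), B u * (2 * l * sinc (l * (y - u)) ^ 2)
        = (∫ t in Ioc (-(2 * l)) (2 * l),
            G (1 + I * t) * ((1 - |t| / (2 * l) : ℝ) : ℂ) * Complex.exp (I * t * y)).re
          + c * ∫ u in Ioi (0 : ℝ), 2 * l * sinc (l * (y - u)) ^ 2 := by
  refine integrableOn_of_tendsto_damped hB0 hgr hl y ?_
  have hKc : Continuous fun u => 2 * l * sinc (l * (y - u)) ^ 2 := by fun_prop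
  have hKle : ∀ u, ‖2 * l * sinc (l * (y - u)) ^ 2‖ ≤ 2 * l := fun u => by
    rw [Real.norm_of_nonneg (fejer_nonneg hl.le _)]; exact fejer_le hl.le _
  -- `J(ε) = Re LHS(ε) + c C(ε)` for `ε > 0`
  have hJ : ∀ ε : ℝ, 0 < ε →
      ∫ u in Ioi (0 : ℝ), B u * rexp (-(ε * u)) * (2 * l * sinc (l * (y - u)) ^ 2)
        = (∫ t in Ioc (-(2 * l)) (2 * l),
            G (1 + ε + I * t) * ((1 - |t| / (2 * l) : ℝ) : ℂ) * Complex.exp (I * t * y)).re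
          + c * ∫ u in Ioi (0 : ℝ), rexp (-(ε * u)) * (2 * l * sinc (l * (y - u)) ^ 2) := by
    intro ε hε
    have hF := laplace_fubini hBm c hε (hgr ε hε) hl y (fun t => G (1 + ε + I * t)) (fun t => by
      rw [hGeq _ (by simp [hε])]
      congr 1
      ext u
      congr 1
      ring_nf)
    rw [hF, Complex.ofReal_re]
    have hi1 : IntegrableOn
        (fun u => B u * rexp (-(ε * u)) * (2 * l * sinc (l * (y - u)) ^ 2)) (Ioi 0) :=
      (hgr ε hε).mul_bdd hKc.aestronglyMeasurable (Eventually.of_forall hKle)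
    have hi2 : IntegrableOn (fun u => rexp (-(ε * u)) * (2 * l * sinc (l * (y - u)) ^ 2)) (Ioi 0) :=
      ((exp_neg_integrableOn_Ioi 0 hε).congr_fun (fun u _ => by ring_nf) measurableSet_Ioi).mul_bdd
        hKc.aestronglyMeasurable (Eventually.of_forall hKle)
    have h3 : ∫ u in Ioi (0 : ℝ), (B u - c) * rexp (-(ε * u)) * (2 * l * sinc (l * (y - u)) ^ 2)
        = (∫ u in Ioi (0 : ℝ), B u * rexp (-(ε * u)) * (2 * l * sinc (l * (y - u)) ^ 2))
          - c * ∫ u in Ioi (0 : ℝ), rexp (-(ε * u)) * (2 * l * sinc (l * (y - u)) ^ 2) := by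
      rw [← MeasureTheory.integral_const_mul, ← integral_sub hi1 (hi2.const_mul c)]
      refine setIntegral_congr_fun measurableSet_Ioi fun u _ => ?_
      ring
    rw [h3]
    ring
  -- take limits `ε → 0⁺`
  have h1 := tendsto_boundary_integral hG hl y
  have h2 := tendsto_exp_fejer_integral hl y
  have h3 := ((Complex.continuous_re.tendsto _).comp h1).add (h2.const_mul c)
  refine h3.congr' ?_
  filter_upwards [self_mem_nhdsWithin] with ε (hε : 0 < ε)
  simp only [Function.comp_apply]
  exact (hJ ε hε).symm

/-- **Convergence of the Fejér means.** Under the hypotheses of the file header, for every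
`λ > 0`, `∫_0^∞ B(u) K_λ(y−u) du → c ∫_ℝ K_1` as `y → ∞` (Riemann–Lebesgue for the boundary term,
`∫_{v<y} K_λ → ∫ K_λ` for the `c`-term). (Montgomery–Vaughan 2007, proof of Thm. 8.6.)
[cite: MontgomeryVaughan2007, §8.3, proof of Thm. 8.6] -/
theorem tendsto_fejerMean_Ioi {B : ℝ → ℝ} (hBm : Measurable B) (hB0 : ∀ u, 0 ≤ B u) (c : ℝ)
    (hgr : ∀ ε : ℝ, 0 < ε → IntegrableOn (fun u => B u * rexp (-(ε * u))) (Ioi 0))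
    {G : ℂ → ℂ} (hG : ContinuousOn G {s : ℂ | 1 ≤ s.re})
    (hGeq : ∀ s : ℂ, 1 < s.re →
      G s = ∫ u in Ioi (0 : ℝ), ((B u - c : ℝ) : ℂ) * Complex.exp (-(s - 1) * u))
    {l : ℝ} (hl : 0 < l) :
    Tendsto (fun y : ℝ => ∫ u in Ioi (0 : ℝ), B u * (2 * l * sinc (l * (y - u)) ^ 2)) atTop
      (𝓝 (c * ∫ x : ℝ, 2 * sinc x ^ 2)) := by
  have heq : (fun y : ℝ => ∫ u in Ioi (0 : ℝ), B u * (2 * l * sinc (l * (y - u)) ^ 2))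
      = fun y : ℝ => (∫ t in Ioc (-(2 * l)) (2 * l),
            G (1 + I * t) * ((1 - |t| / (2 * l) : ℝ) : ℂ) * Complex.exp (I * t * y)).re
          + c * ∫ u in Ioi (0 : ℝ), 2 * l * sinc (l * (y - u)) ^ 2 :=
    funext fun y => (fejerMean_eq_boundary hBm hB0 c hgr hG hGeq hl y).2
  rw [heq]
  have h1 := (Complex.continuous_re.tendsto 0).comp (tendsto_boundary_integral_atTop G l)
  have h2 := (tendsto_setIntegral_Ioi_fejer_sub hl).const_mul c
  simpa using h1.add h2

/-- **Wiener–Ikehara theorem, Laplace-transform form.** This is Montgomery–Vaughan 2007,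
Thm. 8.6 (`a(u)` non-negative increasing on `[0,∞)`, `α(s) = ∫_0^∞ e^{-us} da(u)` convergent for
`σ > 1`, `α(s) − c/(s−1)` continuous on `σ ≥ 1` ⇒ `a(x) = c e^x + o(e^x)`) rewritten in terms of
the density `B(u) = e^{-u} a(u)` and `G(s) = (α(s) − c/(s−1) − c)/s`, using
`α(s) = s ∫_0^∞ B(u) e^{-(s−1)u} du`: let `B : ℝ → ℝ` be measurable, non-negative, zero on
`u ≤ 0`, slowly decreasing in the sense `B(v) ≥ e^{u−v} B(u)` for `u ≤ v` (i.e. `a = e^u B`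
non-decreasing), with `∫_0^∞ B(u) e^{-εu} du < ∞` for all `ε > 0`. If
`G(s) = ∫_0^∞ (B(u) − c) e^{-(s−1)u} du` (`Re s > 1`) extends to a continuous function on the
closed half-plane `Re s ≥ 1`, then `B(u) → c` as `u → ∞`. Proof: `fejerMean_eq_boundary`,
`tendsto_fejerMean_Ioi` and the Tauberian step `tendsto_of_tendsto_fejerMean`.
[cite: MontgomeryVaughan2007, Thm. 8.6] -/
theorem tendsto_of_laplace {B : ℝ → ℝ} (c : ℝ) (hBm : Measurable B) (hB0 : ∀ u, 0 ≤ B u)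
    (hBneg : ∀ u, u ≤ 0 → B u = 0)
    (hmono : ∀ u v, u ≤ v → B u * rexp (u - v) ≤ B v)
    (hgr : ∀ ε : ℝ, 0 < ε → IntegrableOn (fun u => B u * rexp (-(ε * u))) (Ioi 0))
    {G : ℂ → ℂ} (hG : ContinuousOn G {s : ℂ | 1 ≤ s.re})
    (hGeq : ∀ s : ℂ, 1 < s.re →
      G s = ∫ u in Ioi (0 : ℝ), ((B u - c : ℝ) : ℂ) * Complex.exp (-(s - 1) * u)) :
    Tendsto B atTop (𝓝 c) := by
  have hzero : ∀ (l y u : ℝ), u ∉ Ioi (0 : ℝ) → B u * (2 * l * sinc (l * (y - u)) ^ 2) = 0 :=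
    fun l y u hu => by rw [hBneg u (not_lt.1 hu), zero_mul]
  refine tendsto_of_tendsto_fejerMean B c hB0 hmono ?_ ?_ ?_
  · intro T
    refine ⟨B T * rexp T, fun u hu => ?_⟩
    rcases le_or_gt u 0 with h | h
    · rw [hBneg u h]
      exact mul_nonneg (hB0 T) (exp_pos T).le
    · calc B u = B u * rexp (u - T) * rexp (T - u) := by
            rw [mul_assoc, ← Real.exp_add]; simp
        _ ≤ B T * rexp (T - u) := by gcongr; exact hmono u T hu
        _ ≤ B T * rexp T := by gcongr <;> [exact hB0 T; linarith]
  · intro l hl y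
    exact (fejerMean_eq_boundary hBm hB0 c hgr hG hGeq hl y).1.integrable_of_forall_notMem_eq_zero
      (hzero l y)
  · intro l hl
    refine (tendsto_fejerMean_Ioi hBm hB0 c hgr hG hGeq hl).congr fun y => ?_
    exact setIntegral_eq_integral_of_forall_compl_eq_zero (hzero l y)

end Literature.NumberTheory.LFunctions.WienerIkehara

end
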